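import Literature.MathematicalPhysics.QuantumFieldTheory.Balaban1983to89.B1Eq324BenfattoClassPresentation
import HarnessLib

/-!
# `Balaban1983to89.B1Eq324BenfattoClassTorusWindow` — THE BENT WINDOW: a discrete torus `(ℤ/N)^d` injects into `ℤ^{2d}` with cyclic neighbours
# at sup-distance 1, so a Gaussian block on a TORUS is a class member on a window of `ℤ^{2d}` ([Balaban1985UV3] (22)/(58) at the trivial history
# live on the whole unit torus; the class road of this cell — [BenfattoEtAl1978] §5 over [Balaban1985BackgroundPropagators] Sect. E — is typed on `ℤ^d`)

statement-level companion of a published source with citation tags; every declaration here is a theorem; nothing here is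
a claim about the Yang–Mills mass gap

WHY THIS MODULE (cell `pub-ymgap`, seat `dag-n08-b` gen 14, INTENT-4; node N08 [Balaban1985UV3]; seat n08-d's CHECK C «at histories where `Ω_{k+1}`
WRAPS the torus no ℤ^d-Euclidean class member hosts the covariance», seat n08-w4's `N08-CLASS-SOCKET-PRESENTATION-g5.md`).  The class road's output
`…KernelEq324AnyGamma.eq324_kernel_of_expDecay` reads the member ONLY through a finite window `Λ ⊂ ℤ^{d′}` — ANY subset, any `d′` — and Euclidean
decay `|A e e′| ≤ K_A e^{−κ_A|e−e′|₂}`; pavements, corridors, frames, the collar, Appendix A/D and the growth rows are internal to `ℤ^{d′}` and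
never ask where `Λ` came from.  Hence a torus block needs NO torus edition of §5: it suffices to place the torus sites on a BENT window by an
injection `ι : (ℤ/N)^d ↪ ℤ^{d+d}` along which torus-close points stay Euclidean-close (ONE-SIDED Lipschitz; the reverse bound is never used).
Trig-free, every `N ≥ 1`: per coordinate `k ↦ (k, 0)` for `2k ≤ N` («out») and `k ↦ (N − k, 1)` for `2k > N` («back» along the parallel line) —
cyclic neighbours land at sup-distance `≤ 1`, so `|ι x − ι y|_∞ ≤ d_{T,∞}(x,y)` and `|ι x − ι y|₂ ≤ √(2d)·d_{T,∞}(x,y)`.  With seat n08-b's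
`…ClassPresentation.reindex_abs_le_exp_of_dist_le` a precision with TORUS-metric decay then has EUCLIDEAN decay on the bent window (rate `κ/√(2d)`).

WHAT IS PROVED (standard axioms; no `sorry`; no definition — the window map is produced EXISTENTIALLY, its two properties displayed).
* §1 one coordinate (private): the out-and-back map's cyclic step is `≤ 1` in each component; `m` steps move it by `≤ m`; hence by
  `|(y − x).valMinAbs|` (`ZMod.coe_valMinAbs`); injectivity.
* §2 ★★★ `exists_torusWindow` — for all `d N`, `N ≥ 1`: `∃ ι : (Fin d → ZMod N) → (Fin (d + d) → ℤ)`, `Injective ι`, and for all `x y` and every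
  `M : ℤ` with `∀ i, |((x i − y i).valMinAbs : ℤ)| ≤ M`: `∀ j, |ι x j − ι y j| ≤ M` AND `√(Σ_j (ι x j − ι y j)²) ≤ √(d + d)·M`.
* §4 ★★ `exists_torusWindowLabelled` — several variables per site (label `a : Fin m`: bond direction × colour) placed in `ℤ^{d+d+1}` with the label as
  last coordinate: injective on `(site, label)`, coordinates of differences `≤ max M m`, ℓ² `≤ √(d+d+1)·max M m`.
* §5 ★★★ `exists_presentation_of_torusDecay` — ONE-STOP TORUS MEMBER KIT: from `(site, lab)` injective and a symmetric `γ`-coercive `T` with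
  torus-metric decay, `∃ Λ ⊂ ℤ^{2d+1}, e : β ≃ ↥Λ` with the three member rows of `eq324_kernel_of_expDecay` for `reindex e e T` (decay
  `K e^{κm}·e^{−(κ/√(2d+1))|·|₂}`), the Gaussian bridge `(μ_K).map (z ↦ z∘e) = 𝒩(0,T⁻¹)` and the socket's a.e. box identity (via `…ClassPresentation`).
* §3 ★★ `exists_torusWindow_decay` — the same `ι` turns TORUS-metric entrywise decay of any `T : Matrix β β ℝ` along a labelling
  `site : β → (ℤ/N)^d` with bounded fibre spread (`|…| ≤ K e^{−κ ρ}`, `max_i |(site b i − site b′ i).valMinAbs| ≤ ρ b b′`) into the class road's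
  Euclidean decay for `Matrix.reindex e e T` along ANY bijection `e : β ≃ ↥Λ` that sits over `ι ∘ site` up to a bounded offset (`C₀`):
  rate `κ/√(d+d)`, constant `K e^{κ C₀/√(d+d)}` — the hypothesis of `eq324_kernel_of_expDecay` on `ℤ^{d+d}`.
CAVEAT (seat n08-d's concurrence line): the bent image `ι(T) ⊂ ℤ^{2d}` is a thin folded sheet — the knits' `p(η)²`-pad of `J` is NEVER inside
`ι(T)`, so (T4) goes through the PAD-FREE road only (`eq324_kernel_noPad` / `eq324_kernel_of_expDecay`, where seat n08-d's independent collar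
supplies the fictitious sites of `ℤ^{2d} ∖ ι(T)` around `J`); the padded `eq324_kernel` is useless on a bent window.
HONEST SCOPE.  Lattice combinatorics; OUR device (print never leaves the torus: [Balaban1985UV3] works on `T_η`, [BenfattoEtAl1978] on `ℤ^d`); it
removes CHECK C for the class road at the price of the constants `K_{2d}`, `κ/√(2d)`; the IDENT (which `β`, `T`, labelling, Hamiltonian letters,
N06's rows) is NOT commissioned and NOT claimed; count-neutral for N08; nothing about d = 4, the continuum, OS axioms, a mass gap or the Clay problem.
-/

noncomputable section

open Finset Matrix
open scoped BigOperators

namespace Literature.MathematicalPhysics.QuantumFieldTheory.Balaban1983to89.B1Eq324BenfattoClassTorusWindow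

open Literature.MathematicalPhysics.QuantumFieldTheory
open Literature.MathematicalPhysics.QuantumFieldTheory.Balaban1983to89.B1Eq324BenfattoLemma (smallFieldSet)
open Literature.MathematicalPhysics.QuantumFieldTheory.Balaban1983to89.B1Eq324BenfattoClassPresentation
  (reindex_abs_le_exp_of_dist_le reindex_symm reindex_coercive map_restrictAlong_eq preimage_box_ae_eq_smallFieldSet)

/-! ## §1  One coordinate: the out-and-back map `ℤ/N → ℤ × ℤ` -/

section OneCoordinate

variable {N : ℕ}

/-- kernel: the cyclic step of the first component is `≤ 1`: `A(v) = v` for `2v ≤ N`, `N − v` otherwise; `v′ = (v+1) mod N`. [folklore] -/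
private theorem step_fst {v : ℕ} (hv : v < N) :
    |((if 2 * ((v + 1) % N) ≤ N then (((v + 1) % N : ℕ) : ℤ) else (N : ℤ) - (((v + 1) % N : ℕ) : ℤ)) -
        (if 2 * v ≤ N then (v : ℤ) else (N : ℤ) - (v : ℤ)))| ≤ 1 := by
  rcases Nat.lt_or_ge (v + 1) N with h | h
  · rw [Nat.mod_eq_of_lt h]
    split_ifs <;> rw [abs_le] <;> constructor <;> push_cast <;> omega
  · have hv1 : v + 1 = N := le_antisymm hv h
    rw [hv1, Nat.mod_self]
    split_ifs <;> rw [abs_le] <;> constructor <;> push_cast <;> omega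

/-- kernel: the cyclic step of the second component is `≤ 1`: `B(v) = 0` for `2v ≤ N`, `1` otherwise. [folklore] -/
private theorem step_snd {v : ℕ} (hv : v < N) :
    |((if 2 * ((v + 1) % N) ≤ N then (0 : ℤ) else 1) - (if 2 * v ≤ N then (0 : ℤ) else 1))| ≤ 1 := by
  rcases Nat.lt_or_ge (v + 1) N with h | h
  · rw [Nat.mod_eq_of_lt h]
    split_ifs <;> simp
  · have hv1 : v + 1 = N := le_antisymm hv h
    rw [hv1, Nat.mod_self]
    split_ifs <;> simp

variable [NeZero N]

/-- kernel: `(k + 1).val = (k.val + 1) % N`. [folklore] -/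
private theorem val_add_one (k : ZMod N) : (k + 1).val = (k.val + 1) % N := by
  rw [ZMod.val_add, ZMod.val_one_eq_one_mod, Nat.add_mod_mod]

/-- kernel: `m` cyclic steps move both components by at most `m`. [folklore] -/
private theorem iter_bound (k : ZMod N) (m : ℕ) :
    |((if 2 * (k + m).val ≤ N then ((k + m).val : ℤ) else (N : ℤ) - ((k + m).val : ℤ)) -
        (if 2 * k.val ≤ N then (k.val : ℤ) else (N : ℤ) - (k.val : ℤ)))| ≤ m ∧
    |((if 2 * (k + m).val ≤ N then (0 : ℤ) else 1) - (if 2 * k.val ≤ N then (0 : ℤ) else 1))| ≤ m := by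
  induction m with
  | zero => simp
  | succ m ih =>
    have hval : (k + ((m + 1 : ℕ) : ZMod N)).val = ((k + m).val + 1) % N := by
      rw [Nat.cast_succ, ← add_assoc, val_add_one]
    have hlt : (k + m).val < N := ZMod.val_lt _
    have h1 := step_fst hlt
    have h2 := step_snd hlt
    rw [← hval] at h1 h2
    constructor
    · calc _ ≤ |((if 2 * (k + ((m + 1 : ℕ) : ZMod N)).val ≤ N then ((k + ((m + 1 : ℕ) : ZMod N)).val : ℤ)
                else (N : ℤ) - ((k + ((m + 1 : ℕ) : ZMod N)).val : ℤ)) -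
              (if 2 * (k + m).val ≤ N then ((k + m).val : ℤ) else (N : ℤ) - ((k + m).val : ℤ)))| +
            |((if 2 * (k + m).val ≤ N then ((k + m).val : ℤ) else (N : ℤ) - ((k + m).val : ℤ)) -
              (if 2 * k.val ≤ N then (k.val : ℤ) else (N : ℤ) - (k.val : ℤ)))| := abs_sub_le _ _ _
        _ ≤ 1 + m := add_le_add h1 ih.1
        _ = (m + 1 : ℕ) := by push_cast; ring
    · calc _ ≤ |((if 2 * (k + ((m + 1 : ℕ) : ZMod N)).val ≤ N then (0 : ℤ) else 1) - (if 2 * (k + m).val ≤ N then (0 : ℤ) else 1))| +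
            |((if 2 * (k + m).val ≤ N then (0 : ℤ) else 1) - (if 2 * k.val ≤ N then (0 : ℤ) else 1))| := abs_sub_le _ _ _
        _ ≤ 1 + m := add_le_add h2 ih.2
        _ = (m + 1 : ℕ) := by push_cast; ring

/-- kernel: the out-and-back map is `1`-Lipschitz from the cyclic distance `|(y − x).valMinAbs|` to the sup-distance, in each component. [folklore] -/
private theorem dist_bound (x y : ZMod N) :
    |((if 2 * y.val ≤ N then (y.val : ℤ) else (N : ℤ) - (y.val : ℤ)) - (if 2 * x.val ≤ N then (x.val : ℤ) else (N : ℤ) - (x.val : ℤ)))| ≤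
        |((y - x).valMinAbs : ℤ)| ∧
    |((if 2 * y.val ≤ N then (0 : ℤ) else 1) - (if 2 * x.val ≤ N then (0 : ℤ) else 1))| ≤ |((y - x).valMinAbs : ℤ)| := by
  set z : ℤ := (y - x).valMinAbs with hz
  rcases le_or_gt 0 z with h0 | h0
  · -- `y = x + |z|` steps forward
    have hy : y = x + (z.natAbs : ℕ) := by
      have h1 : ((z.natAbs : ℕ) : ZMod N) = ((z : ℤ) : ZMod N) := by
        rw [← Int.cast_natCast, Int.natAbs_of_nonneg h0]
      rw [h1, hz, ZMod.coe_valMinAbs, add_sub_cancel]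
    have hb := iter_bound x z.natAbs
    rw [← hy] at hb
    have habs : ((z.natAbs : ℕ) : ℤ) = |z| := Int.natCast_natAbs z
    rw [habs] at hb
    exact hb
  · -- `x = y + |z|` steps forward from `y`
    have hx : x = y + ((-z).natAbs : ℕ) := by
      have h1 : (((-z).natAbs : ℕ) : ZMod N) = (((-z) : ℤ) : ZMod N) := by
        rw [← Int.cast_natCast, Int.natAbs_of_nonneg (by omega)]
      rw [h1, Int.cast_neg, hz, ZMod.coe_valMinAbs, neg_sub, add_sub_cancel]
    have hb := iter_bound y (-z).natAbs
    rw [← hx] at hb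
    have habs : (((-z).natAbs : ℕ) : ℤ) = |z| := by rw [Int.natCast_natAbs, abs_neg]
    rw [habs] at hb
    rw [abs_sub_comm] at hb
    refine ⟨hb.1, ?_⟩
    rw [abs_sub_comm]
    exact hb.2

/-- kernel: the out-and-back map is injective. [folklore] -/
private theorem injective_outBack {x y : ZMod N}
    (h1 : (if 2 * x.val ≤ N then (x.val : ℤ) else (N : ℤ) - (x.val : ℤ)) = (if 2 * y.val ≤ N then (y.val : ℤ) else (N : ℤ) - (y.val : ℤ)))
    (h2 : (if 2 * x.val ≤ N then (0 : ℤ) else 1) = (if 2 * y.val ≤ N then (0 : ℤ) else 1)) : x = y := by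
  apply ZMod.val_injective N
  have hx := ZMod.val_lt x
  have hy := ZMod.val_lt y
  by_cases hxa : 2 * x.val ≤ N <;> by_cases hya : 2 * y.val ≤ N <;> simp only [hxa, hya, if_true, if_false] at h1 h2 <;> omega

end OneCoordinate

/-! ## §2  The bent window `ι : (ℤ/N)^d ↪ ℤ^{d+d}` -/

/-- ★★★ **THE BENT WINDOW** — for every `d` and `N ≥ 1` there is an INJECTION `ι : (ℤ/N)^d → ℤ^{d+d}` along which cyclically close points stay
close: whenever `|(x i − y i).valMinAbs| ≤ M` for all coordinates `i` (the torus sup-distance is `≤ M`), every coordinate of `ι x − ι y` is `≤ M`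
in absolute value, and `|ι x − ι y|₂ ≤ √(d+d)·M`.  (First `d` coordinates: `k ↦ k` resp. `N − k`; last `d`: the «out/back» flag `0/1`.)
Consequently a class member may be PRESENTED on the window `ι(T)` of `ℤ^{d+d}` (`…ClassPresentation`), with no torus edition of the §5 geometry.
[cite: Balaban1985UV3, (18) p.260, (22) p.261, (58) p.270 (the step's Gaussian lives on the unit torus);
BenfattoEtAl1978, §1 p.144 (the lemma's field on `Q₀ = ℤ^d`) (the device is ours)] -/
theorem exists_torusWindow (d N : ℕ) [NeZero N] :
    ∃ ι : (Fin d → ZMod N) → (Fin (d + d) → ℤ), Function.Injective ι ∧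
      ∀ (x y : Fin d → ZMod N) (M : ℤ), (∀ i, |((x i - y i).valMinAbs : ℤ)| ≤ M) →
        (∀ j, |ι x j - ι y j| ≤ M) ∧ Real.sqrt (∑ j, (((ι x j : ℤ) : ℝ) - ((ι y j : ℤ) : ℝ)) ^ 2) ≤ Real.sqrt (d + d) * M := by
  set F : (Fin d → ZMod N) → Fin (d + d) → ℤ := fun x =>
    Fin.append (fun i => if 2 * (x i).val ≤ N then ((x i).val : ℤ) else (N : ℤ) - ((x i).val : ℤ))
      (fun i => if 2 * (x i).val ≤ N then (0 : ℤ) else 1) with hF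
  refine ⟨F, ?_, ?_⟩
  · -- injectivity, coordinate by coordinate
    intro x y hxy
    funext i
    have h1 := congr_fun hxy (Fin.castAdd d i)
    have h2 := congr_fun hxy (Fin.natAdd d i)
    simp only [hF, Fin.append_left, Fin.append_right] at h1 h2
    exact injective_outBack h1 h2
  · intro x y M hM
    -- the sup bound, coordinate by coordinate
    have hsup : ∀ j, |F x j - F y j| ≤ M := by
      intro j
      refine Fin.addCases (fun i => ?_) (fun i => ?_) j
      · simp only [hF, Fin.append_left]
        exact (dist_bound (y i) (x i)).1.trans (hM i)
      · simp only [hF, Fin.append_right]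
        exact (dist_bound (y i) (x i)).2.trans (hM i)
    refine ⟨hsup, ?_⟩
    -- the ℓ² bound
    have hterm : ∀ j : Fin (d + d), (((F x j : ℤ) : ℝ) - ((F y j : ℤ) : ℝ)) ^ 2 ≤ (M : ℝ) ^ 2 := by
      intro j
      have h' : |(((F x j : ℤ) : ℝ) - ((F y j : ℤ) : ℝ))| ≤ (M : ℝ) := by
        rw [← Int.cast_sub, ← Int.cast_abs]
        exact_mod_cast hsup j
      calc _ = |(((F x j : ℤ) : ℝ) - ((F y j : ℤ) : ℝ))| ^ 2 := (sq_abs _).symm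
        _ ≤ (M : ℝ) ^ 2 := pow_le_pow_left₀ (abs_nonneg _) h' 2
    rcases Nat.eq_zero_or_pos d with hd | hd
    · subst hd
      simp
    · have hMnn : (0 : ℝ) ≤ M := by exact_mod_cast (abs_nonneg _).trans (hM ⟨0, hd⟩)
      calc Real.sqrt (∑ j, (((F x j : ℤ) : ℝ) - ((F y j : ℤ) : ℝ)) ^ 2)
          ≤ Real.sqrt (∑ _j : Fin (d + d), (M : ℝ) ^ 2) := Real.sqrt_le_sqrt (Finset.sum_le_sum fun j _ => hterm j)
        _ = Real.sqrt ((d + d : ℕ) * (M : ℝ) ^ 2) := by rw [Finset.sum_const, Finset.card_univ, Fintype.card_fin, nsmul_eq_mul]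
        _ = Real.sqrt (d + d) * M := by
            rw [Real.sqrt_mul (by positivity), Real.sqrt_sq hMnn]
            push_cast
            ring

/-! ## §3  Torus-metric decay becomes Euclidean decay on the bent window -/

/-- ★★ **TORUS-METRIC DECAY ⇒ THE CLASS ROAD'S EUCLIDEAN DECAY ON THE BENT WINDOW.**  Let the variables `β` carry torus sites `site : β → (ℤ/N)^d`, let
`T : Matrix β β ℝ` decay in a pseudo-distance `ρ` dominating the torus sup-distance of the sites (`|T b b′| ≤ K e^{−κ ρ(b,b′)}`,
`|(site b i − site b′ i).valMinAbs| ≤ ρ(b,b′)` for all `i`), and let `e : β ≃ ↥Λ` be ANY bijection onto a window `Λ ⊂ ℤ^{d+d}` whose points sit over the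
bent window up to a bounded offset: `|e b − ι(site b)|₂ ≤ C₀/2` (room for the IDENT's bond-direction / colour labels).  Then
`|(reindex e e T) x y| ≤ K e^{κ C₀/√(d+d)}·e^{−(κ/√(d+d))|x − y|₂}` — the decay hypothesis of `…KernelEq324AnyGamma.eq324_kernel_of_expDecay` on `ℤ^{d+d}`
(for `d ≥ 1`). [cite: Balaban1985BackgroundPropagators, (1.16)–(1.18) p.180, Sect. E p.428 «a uniform exponential decay»; Balaban1985UV3, p.261
«a covariance having an exponential decay property» (on the torus; the transfer is ours)] -/
theorem exists_torusWindow_decay (d N : ℕ) [NeZero N] (hd : 0 < d) :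
    ∃ ι : (Fin d → ZMod N) → (Fin (d + d) → ℤ), Function.Injective ι ∧
      ∀ {β : Type*} (site : β → Fin d → ZMod N) {Λ : Finset (B1Eq324BenfattoLemma.Site (d + d))} (e : β ≃ ↥Λ)
        {T : Matrix β β ℝ} {K κ C₀ : ℝ} {ρ : β → β → ℝ}, 0 ≤ K → 0 ≤ κ →
        (∀ b b', |T b b'| ≤ K * Real.exp (-(κ * ρ b b'))) →
        (∀ b b' i, (|((site b i - site b' i).valMinAbs : ℤ)| : ℝ) ≤ ρ b b') →
        (∀ b, Real.sqrt (∑ j, (((((e b : ↥Λ) : B1Eq324BenfattoLemma.Site (d + d)) j : ℝ) - ((ι (site b) j : ℤ) : ℝ))) ^ 2) ≤ C₀ / 2) →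
        ∀ x y : ↥Λ, |(Matrix.reindex e e T) x y| ≤
          K * Real.exp (κ * C₀ / Real.sqrt (d + d)) * Real.exp (-(κ / Real.sqrt (d + d) *
            Real.sqrt (∑ j, ((((x : B1Eq324BenfattoLemma.Site (d + d)) j : ℝ) - ((y : B1Eq324BenfattoLemma.Site (d + d)) j : ℝ))) ^ 2))) := by
  obtain ⟨ι, hι, hdist⟩ := exists_torusWindow d N
  refine ⟨ι, hι, fun site Λ e T K κ C₀ ρ hK hκ hdec hρ hoff => ?_⟩
  have hC₁ : 0 < Real.sqrt (d + d) := Real.sqrt_pos.mpr (by positivity)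
  refine reindex_abs_le_exp_of_dist_le e hK hκ hC₁ hdec fun b b' => ?_
  -- |e b − e b'| ≤ |e b − ι b| + |ι b − ι b'| + |ι b' − e b'| ≤ C₀/2 + √(2d)·ρ + C₀/2
  have hιbb : Real.sqrt (∑ j, (((ι (site b) j : ℤ) : ℝ) - ((ι (site b') j : ℤ) : ℝ)) ^ 2) ≤ Real.sqrt (d + d) * ρ b b' := by
    -- round ρ down to an integer bound? use M := ⌈ρ⌉? we need an integer M with |valMinAbs| ≤ M and √(2d) M ≤ √(2d) ρ: take the real route instead
    have key : ∀ j, (((ι (site b) j : ℤ) : ℝ) - ((ι (site b') j : ℤ) : ℝ)) ^ 2 ≤ ρ b b' ^ 2 := by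
      intro j
      -- integer bound with M := max_i |valMinAbs| realised as an integer
      classical
      let M : ℤ := Finset.univ.sup' ⟨⟨0, hd⟩, Finset.mem_univ _⟩ fun i => |((site b i - site b' i).valMinAbs : ℤ)|
      have hMi : ∀ i, |((site b i - site b' i).valMinAbs : ℤ)| ≤ M := fun i =>
        Finset.le_sup' (fun i => |((site b i - site b' i).valMinAbs : ℤ)|) (Finset.mem_univ i)
      have hMρ : (M : ℝ) ≤ ρ b b' := by
        obtain ⟨i₀, -, hi₀⟩ := Finset.exists_mem_eq_sup' ⟨⟨0, hd⟩, Finset.mem_univ _⟩ fun i => |((site b i - site b' i).valMinAbs : ℤ)|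
        have : (M : ℝ) = (|((site b i₀ - site b' i₀).valMinAbs : ℤ)| : ℝ) := by
          rw [show M = |((site b i₀ - site b' i₀).valMinAbs : ℤ)| from hi₀, Int.cast_abs]
        rw [this]
        exact hρ b b' i₀
      have h1 := ((hdist (site b) (site b') M hMi).1 j)
      have h1' : |(((ι (site b) j : ℤ) : ℝ) - ((ι (site b') j : ℤ) : ℝ))| ≤ (M : ℝ) := by
        rw [← Int.cast_sub, ← Int.cast_abs]; exact_mod_cast h1
      have hρ0 : 0 ≤ ρ b b' := le_trans (by exact_mod_cast (abs_nonneg _).trans (hMi ⟨0, hd⟩)) hMρ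
      calc _ = |(((ι (site b) j : ℤ) : ℝ) - ((ι (site b') j : ℤ) : ℝ))| ^ 2 := (sq_abs _).symm
        _ ≤ ρ b b' ^ 2 := pow_le_pow_left₀ (abs_nonneg _) (h1'.trans hMρ) 2
    have hρ0 : 0 ≤ ρ b b' := le_trans (by positivity) (hρ b b' ⟨0, hd⟩)
    calc Real.sqrt (∑ j, _) ≤ Real.sqrt (∑ _j : Fin (d + d), ρ b b' ^ 2) := Real.sqrt_le_sqrt (Finset.sum_le_sum fun j _ => key j)
      _ = Real.sqrt (d + d) * ρ b b' := by
          rw [Finset.sum_const, Finset.card_univ, Fintype.card_fin, nsmul_eq_mul, Real.sqrt_mul (by positivity), Real.sqrt_sq hρ0]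
          push_cast; ring
  -- triangle inequality in `EuclideanSpace`-free form: use the ℓ² norm on `Fin (d+d) → ℝ` via `Real.sqrt (Σ ·²)` = `‖WithLp.toLp 2 ·‖`
  have hnorm : ∀ f : Fin (d + d) → ℝ, Real.sqrt (∑ j, f j ^ 2) = ‖(WithLp.toLp 2 f : EuclideanSpace ℝ (Fin (d + d)))‖ := by
    intro f
    rw [EuclideanSpace.norm_eq]
    congr 1
    refine Finset.sum_congr rfl fun j _ => ?_
    rw [show (WithLp.toLp 2 f : EuclideanSpace ℝ (Fin (d + d))) j = f j from rfl, Real.norm_eq_abs, sq_abs]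
  have htri : ∀ u v w : Fin (d + d) → ℝ,
      Real.sqrt (∑ j, (u j - w j) ^ 2) ≤ Real.sqrt (∑ j, (u j - v j) ^ 2) + Real.sqrt (∑ j, (v j - w j) ^ 2) := by
    intro u v w
    have e1 : ∑ j, (u j - w j) ^ 2 = ∑ j, (u - w) j ^ 2 := Finset.sum_congr rfl fun j _ => rfl
    have e2 : ∑ j, (u j - v j) ^ 2 = ∑ j, (u - v) j ^ 2 := Finset.sum_congr rfl fun j _ => rfl
    have e3 : ∑ j, (v j - w j) ^ 2 = ∑ j, (v - w) j ^ 2 := Finset.sum_congr rfl fun j _ => rfl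
    rw [e1, e2, e3, hnorm, hnorm, hnorm]
    have hsplit : (WithLp.toLp 2 (u - w) : EuclideanSpace ℝ (Fin (d + d))) = WithLp.toLp 2 (u - v) + WithLp.toLp 2 (v - w) := by
      rw [← WithLp.toLp_add, sub_add_sub_cancel]
    rw [hsplit]
    exact norm_add_le _ _
  set u : Fin (d + d) → ℝ := fun j => (((e b : ↥Λ) : B1Eq324BenfattoLemma.Site (d + d)) j : ℝ) with hu
  set v : Fin (d + d) → ℝ := fun j => ((ι (site b) j : ℤ) : ℝ) with hv
  set v' : Fin (d + d) → ℝ := fun j => ((ι (site b') j : ℤ) : ℝ) with hv'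
  set w : Fin (d + d) → ℝ := fun j => (((e b' : ↥Λ) : B1Eq324BenfattoLemma.Site (d + d)) j : ℝ) with hw
  have h1 : Real.sqrt (∑ j, (u j - v j) ^ 2) ≤ C₀ / 2 := hoff b
  have h2 : Real.sqrt (∑ j, (v j - v' j) ^ 2) ≤ Real.sqrt (d + d) * ρ b b' := hιbb
  have h3 : Real.sqrt (∑ j, (v' j - w j) ^ 2) ≤ C₀ / 2 := by
    have := hoff b'
    have hsymm : ∑ j, (v' j - w j) ^ 2 = ∑ j, (w j - v' j) ^ 2 := Finset.sum_congr rfl fun j _ => by ring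
    rw [hsymm]; exact this
  calc Real.sqrt (∑ j, (u j - w j) ^ 2) ≤ Real.sqrt (∑ j, (u j - v j) ^ 2) + Real.sqrt (∑ j, (v j - w j) ^ 2) := htri u v w
    _ ≤ Real.sqrt (∑ j, (u j - v j) ^ 2) + (Real.sqrt (∑ j, (v j - v' j) ^ 2) + Real.sqrt (∑ j, (v' j - w j) ^ 2)) :=
        add_le_add le_rfl (htri v v' w)
    _ ≤ C₀ / 2 + (Real.sqrt (d + d) * ρ b b' + C₀ / 2) := add_le_add h1 (add_le_add h2 h3)
    _ = Real.sqrt (d + d) * ρ b b' + C₀ := by ring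

/-! ## §4  Several variables per torus site: the labelled bent window in `ℤ^{d+d+1}` -/

/-- ★★ **THE LABELLED BENT WINDOW** — variables carrying a torus site AND a label `a : Fin m` ([Balaban1985UV3]: bond direction × `su(N)` component) are
placed injectively in `ℤ^{d+d+1}` (the bent window of §2 with the label as last coordinate): for `(x, a)`, `(y, a′)` with torus sup-distance `≤ M`
(`M ≥ 0`) every coordinate of the difference is `≤ max M m`, and the ℓ² distance is `≤ √(d+d+1)·max M m`.  So the IDENT's bijection
`e := ι ∘ (site, label)` onto its image satisfies `…ClassPresentation.reindex_abs_le_exp_of_dist_le`'s distortion hypothesis with `C₁ = √(d+d+1)`,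
`C₀ = √(d+d+1)·m`. [cite: Balaban1985UV3, (18) p.260 (bond variables `A(b)` with values in the Lie algebra), (58) p.270 (the device is ours)] -/
theorem exists_torusWindowLabelled (d N m : ℕ) [NeZero N] :
    ∃ ι : (Fin d → ZMod N) × Fin m → (Fin (d + d + 1) → ℤ), Function.Injective ι ∧
      ∀ (x y : Fin d → ZMod N) (a a' : Fin m) (M : ℤ), 0 ≤ M → (∀ i, |((x i - y i).valMinAbs : ℤ)| ≤ M) →
        (∀ j, |ι (x, a) j - ι (y, a') j| ≤ max M (m : ℤ)) ∧
          Real.sqrt (∑ j, (((ι (x, a) j : ℤ) : ℝ) - ((ι (y, a') j : ℤ) : ℝ)) ^ 2) ≤ Real.sqrt (d + d + 1) * max (M : ℝ) (m : ℝ) := by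
  obtain ⟨ι₀, hι₀, hdist⟩ := exists_torusWindow d N
  refine ⟨fun p => Fin.snoc (ι₀ p.1) ((p.2 : ℕ) : ℤ), ?_, ?_⟩
  · rintro ⟨x, a⟩ ⟨y, a'⟩ h
    obtain ⟨h1, h2⟩ := Fin.snoc_injective2 h
    have hxy : x = y := hι₀ h1
    have haa : a = a' := Fin.ext (by exact_mod_cast h2)
    rw [hxy, haa]
  · intro x y a a' M hM0 hM
    have hsup : ∀ j, |(Fin.snoc (ι₀ x) ((a : ℕ) : ℤ) : Fin (d + d + 1) → ℤ) j - (Fin.snoc (ι₀ y) ((a' : ℕ) : ℤ) : Fin (d + d + 1) → ℤ) j| ≤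
        max M (m : ℤ) := by
      intro j
      refine Fin.lastCases ?_ (fun j' => ?_) j
      · simp only [Fin.snoc_last]
        have ha := a.2
        have ha' := a'.2
        exact le_max_of_le_right (by rw [abs_le]; constructor <;> omega)
      · simp only [Fin.snoc_castSucc]
        exact ((hdist x y M hM).1 j').trans (le_max_left _ _)
    refine ⟨hsup, ?_⟩
    have hMm : (0 : ℝ) ≤ max (M : ℝ) (m : ℝ) := le_max_of_le_right (Nat.cast_nonneg m)
    have hcast : ((max M (m : ℤ) : ℤ) : ℝ) = max (M : ℝ) (m : ℝ) := by rw [Int.cast_max, Int.cast_natCast]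
    have hterm : ∀ j, ((((Fin.snoc (ι₀ x) ((a : ℕ) : ℤ) : Fin (d + d + 1) → ℤ) j : ℤ) : ℝ) -
        (((Fin.snoc (ι₀ y) ((a' : ℕ) : ℤ) : Fin (d + d + 1) → ℤ) j : ℤ) : ℝ)) ^ 2 ≤ (max (M : ℝ) (m : ℝ)) ^ 2 := by
      intro j
      have h' : |((((Fin.snoc (ι₀ x) ((a : ℕ) : ℤ) : Fin (d + d + 1) → ℤ) j : ℤ) : ℝ) -
          (((Fin.snoc (ι₀ y) ((a' : ℕ) : ℤ) : Fin (d + d + 1) → ℤ) j : ℤ) : ℝ))| ≤ max (M : ℝ) (m : ℝ) := by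
        rw [← Int.cast_sub, ← Int.cast_abs, ← hcast]
        exact_mod_cast hsup j
      calc _ = |((((Fin.snoc (ι₀ x) ((a : ℕ) : ℤ) : Fin (d + d + 1) → ℤ) j : ℤ) : ℝ) -
          (((Fin.snoc (ι₀ y) ((a' : ℕ) : ℤ) : Fin (d + d + 1) → ℤ) j : ℤ) : ℝ))| ^ 2 := (sq_abs _).symm
        _ ≤ (max (M : ℝ) (m : ℝ)) ^ 2 := pow_le_pow_left₀ (abs_nonneg _) h' 2
    calc Real.sqrt (∑ j, _) ≤ Real.sqrt (∑ _j : Fin (d + d + 1), (max (M : ℝ) (m : ℝ)) ^ 2) :=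
          Real.sqrt_le_sqrt (Finset.sum_le_sum fun j _ => hterm j)
      _ = Real.sqrt ((d + d + 1 : ℕ) * (max (M : ℝ) (m : ℝ)) ^ 2) := by rw [Finset.sum_const, Finset.card_univ, Fintype.card_fin, nsmul_eq_mul]
      _ = Real.sqrt (d + d + 1) * max (M : ℝ) (m : ℝ) := by
          rw [Real.sqrt_mul (by positivity), Real.sqrt_sq hMm]
          push_cast
          ring

/-! ## §5  One-stop: the torus block's Gaussian PRESENTED as a class member in Sect. E currency on the labelled bent window -/

/-- ★★★ **THE TORUS MEMBER KIT** — variables `β` with torus sites `site : β → (ℤ/N)^d` (`d ≥ 1`) and labels `lab : β → Fin m`, `(site, lab)` injective; a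
precision `T : Matrix β β ℝ` symmetric, `γ`-coercive, decaying `|T b b′| ≤ K e^{−κ ρ(b,b′)}` in any `ρ` dominating the torus sup-distance of the sites.
THEN there are a window `Λ ⊂ ℤ^{d+d+1}` and a bijection `e : β ≃ ↥Λ` such that the re-indexed precision `A = reindex e e T` is symmetric,
`γ`-coercive, decays in the EUCLIDEAN metric of the window as `K e^{κm}·e^{−(κ/√(2d+1))|x−y|₂}` (the three member rows of
`…KernelEq324AnyGamma.eq324_kernel_of_expDecay` on `ℤ^{d+d+1}`), the class road's field `μ_K` (`K` = zero-extended `A⁻¹`) PRESENTS `𝒩(0, T⁻¹)` under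
`Φ z = z ∘ e`, and the uniform-threshold box pulls back to `smallFieldSet Λ p` a.e. — everything seat n08-w4's `…RowClassSocketEnd` asks of the member
except the Hamiltonian letters (`𝒱 ∘ Φ =ᵐ H^a_J`, `coefSup ≤ c₀ g^σ`: the IDENT's class-II content).  No torus edition of §5 of [BenfattoEtAl1978] is used.
[cite: Balaban1985UV3, (18) p.260, (22) p.261, (58) p.270, p.261 «a covariance having an exponential decay property»;
Balaban1985BackgroundPropagators, Sect. E p.428 «a lower bound γ₀ > 0 … a uniform exponential decay» (class form; the bent window is ours)] -/
theorem exists_presentation_of_torusDecay (d N m : ℕ) [NeZero N] (hd : 0 < d) {β : Type*} [Fintype β] [DecidableEq β]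
    (site : β → Fin d → ZMod N) (lab : β → Fin m) (hinj : Function.Injective fun b => (site b, lab b))
    {T : Matrix β β ℝ} (hTs : ∀ b b', T b b' = T b' b) {γ : ℝ} (hγ0 : 0 < γ)
    (hγ : ∀ v : β → ℝ, γ * ∑ b, v b ^ 2 ≤ ∑ b, ∑ b', T b b' * v b * v b')
    {K κ : ℝ} {ρ : β → β → ℝ} (hK : 0 ≤ K) (hκ : 0 ≤ κ) (hdec : ∀ b b', |T b b'| ≤ K * Real.exp (-(κ * ρ b b')))
    (hρ : ∀ b b' i, (|((site b i - site b' i).valMinAbs : ℤ)| : ℝ) ≤ ρ b b') :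
    ∃ (Λ : Finset (B1Eq324BenfattoLemma.Site (d + d + 1))) (e : β ≃ ↥Λ),
      (∀ x y : ↥Λ, (Matrix.reindex e e T) x y = (Matrix.reindex e e T) y x) ∧
      (∀ w : ↥Λ → ℝ, γ * ∑ x, w x ^ 2 ≤ ∑ x, ∑ y, (Matrix.reindex e e T) x y * w x * w y) ∧
      (∀ x y : ↥Λ, |(Matrix.reindex e e T) x y| ≤ K * Real.exp (κ * m) * Real.exp (-(κ / Real.sqrt (d + d + 1) *
        Real.sqrt (∑ j, ((((x : B1Eq324BenfattoLemma.Site (d + d + 1)) j : ℝ) - ((y : B1Eq324BenfattoLemma.Site (d + d + 1)) j : ℝ))) ^ 2)))) ∧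
      ((gaussianFieldOfKernel fun x y => if h : x ∈ Λ ∧ y ∈ Λ then ((Matrix.reindex e e T)⁻¹ : Matrix ↥Λ ↥Λ ℝ) ⟨x, h.1⟩ ⟨y, h.2⟩ else 0).map
          (fun (z : B1Eq324BenfattoLemma.Site (d + d + 1) → ℝ) (b : β) => z ((e b : ↥Λ) : B1Eq324BenfattoLemma.Site (d + d + 1))) =
        gaussianFieldOfKernel fun b b' => (T⁻¹ : Matrix β β ℝ) b b') ∧
      (∀ p : ℝ, 0 ≤ p →
        ((fun (z : B1Eq324BenfattoLemma.Site (d + d + 1) → ℝ) (b : β) => z ((e b : ↥Λ) : B1Eq324BenfattoLemma.Site (d + d + 1))) ⁻¹'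
            {ω : β → ℝ | ∀ b, |ω b| ≤ p}) =ᵐ[gaussianFieldOfKernel fun x y =>
              if h : x ∈ Λ ∧ y ∈ Λ then ((Matrix.reindex e e T)⁻¹ : Matrix ↥Λ ↥Λ ℝ) ⟨x, h.1⟩ ⟨y, h.2⟩ else 0] smallFieldSet Λ p) := by
  classical
  obtain ⟨ι, hι, hdist⟩ := exists_torusWindowLabelled d N m
  -- the injective placement of the variables and the window
  set f : β → B1Eq324BenfattoLemma.Site (d + d + 1) := fun b => ι (site b, lab b) with hf
  have hfinj : Function.Injective f := fun b b' h => hinj (hι h)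
  let Λ : Finset (B1Eq324BenfattoLemma.Site (d + d + 1)) := Finset.univ.image f
  have hmem : ∀ b, f b ∈ Λ := fun b => Finset.mem_image_of_mem f (Finset.mem_univ b)
  let e : β ≃ ↥Λ := Equiv.ofBijective (fun b => ⟨f b, hmem b⟩)
    ⟨fun b b' h => hfinj (Subtype.ext_iff.mp h), fun x => by
      obtain ⟨b, -, hb⟩ := Finset.mem_image.mp x.2
      exact ⟨b, Subtype.ext hb⟩⟩
  have he : ∀ b, ((e b : ↥Λ) : B1Eq324BenfattoLemma.Site (d + d + 1)) = ι (site b, lab b) := fun b => rfl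
  refine ⟨Λ, e, reindex_symm e hTs, reindex_coercive e hγ, ?_, map_restrictAlong_eq e (fun x y => rfl) hTs hγ0 hγ,
    fun p hp => preimage_box_ae_eq_smallFieldSet e (fun x y => rfl) hTs hγ0 hγ hp⟩
  -- the Euclidean decay on the bent window: distortion `√(2d+1)·ρ + √(2d+1)·m`
  have hC₁ : 0 < Real.sqrt (d + d + 1) := Real.sqrt_pos.mpr (by positivity)
  have hD : ∀ b b', Real.sqrt (∑ j, (((((e b : ↥Λ) : B1Eq324BenfattoLemma.Site (d + d + 1)) j : ℝ) -
      (((e b' : ↥Λ) : B1Eq324BenfattoLemma.Site (d + d + 1)) j : ℝ))) ^ 2) ≤ Real.sqrt (d + d + 1) * ρ b b' + Real.sqrt (d + d + 1) * m := by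
    intro b b'
    -- the integer bound `M := max_i |valMinAbs|` and `M ≤ ρ`
    let M : ℤ := Finset.univ.sup' ⟨⟨0, hd⟩, Finset.mem_univ _⟩ fun i => |((site b i - site b' i).valMinAbs : ℤ)|
    have hMi : ∀ i, |((site b i - site b' i).valMinAbs : ℤ)| ≤ M := fun i =>
      Finset.le_sup' (fun i => |((site b i - site b' i).valMinAbs : ℤ)|) (Finset.mem_univ i)
    have hM0 : 0 ≤ M := (abs_nonneg _).trans (hMi ⟨0, hd⟩)
    have hMρ : (M : ℝ) ≤ ρ b b' := by
      obtain ⟨i₀, -, hi₀⟩ := Finset.exists_mem_eq_sup' ⟨⟨0, hd⟩, Finset.mem_univ _⟩ fun i => |((site b i - site b' i).valMinAbs : ℤ)|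
      have : (M : ℝ) = (|((site b i₀ - site b' i₀).valMinAbs : ℤ)| : ℝ) := by
        rw [show M = |((site b i₀ - site b' i₀).valMinAbs : ℤ)| from hi₀, Int.cast_abs]
      rw [this]
      exact hρ b b' i₀
    have h := (hdist (site b) (site b') (lab b) (lab b') M hM0 hMi).2
    simp only [he]
    refine h.trans ?_
    have hmax : max (M : ℝ) (m : ℝ) ≤ ρ b b' + m :=
      max_le (by linarith [(Nat.cast_nonneg m : (0 : ℝ) ≤ m)]) (by linarith [(by exact_mod_cast hM0 : (0 : ℝ) ≤ M)])
    calc Real.sqrt (d + d + 1) * max (M : ℝ) (m : ℝ) ≤ Real.sqrt (d + d + 1) * (ρ b b' + m) := mul_le_mul_of_nonneg_left hmax hC₁.le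
      _ = _ := by ring
  have hdec' := reindex_abs_le_exp_of_dist_le e hK hκ hC₁ hdec hD
  intro x y
  have h := hdec' x y
  have hconst : κ * (Real.sqrt (d + d + 1) * m) / Real.sqrt (d + d + 1) = κ * m := by
    field_simp
  rw [hconst] at h
  exact h

end Literature.MathematicalPhysics.QuantumFieldTheory.Balaban1983to89.B1Eq324BenfattoClassTorusWindow
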